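import Mathlib
import Literature.Combinatorics.Enumerative.MotzkinWords
import Literature.Combinatorics.Enumerative.LatticePathBallotNumbers
import Literature.Combinatorics.Enumerative.CentrosymmetricInvolutionsMotzkinPath
import HarnessLib

/-!
# Motzkin prefixes, symmetric Motzkin paths, and `|CI_n(3412)| = |CI_n(4321)| = Σ_i binom(h,i) binom(i,⌊i/2⌋)`
# (Barnabei–Bonetti–Silimbani 2011, Theorem 13)

Topic `Combinatorics/Enumerative`, namespace `Literature.Combinatorics.Enumerative`; ONE definition (`motzkinPrefixes n`,
the left factors of Motzkin paths) and proved theorems; no named facts, no `sorry`.  Sequel of `MotzkinWords.lean`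
(`motzkinWords n`, support sorting onto the Dyck words `ballotSets`), `LatticePathBallotNumbers.lean` (`weakBallotSets 1 m`:
the left factors of Dyck paths, `#· = binom(m, ⌊m/2⌋)`) and `CentrosymmetricInvolutionsMotzkinPath.lean`
(`|CI_n(3412)| = |CI_n(4321)| = #{symmetric Motzkin words of length n}`).

## Source, verbatim

M. Barnabei, F. Bonetti, M. Silimbani, *Restricted involutions and Motzkin paths*, Adv. Appl. Math. **47** (2011)
102–115 = arXiv:0812.0463 [BarnabeiBonettiSilimbani2011] (held text `paper-arxiv-0812.0463`, p0009, arXiv §7):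

> **Theorem 13.** For every integer `h`,
> `|CI_{2h+1}(4321)| = |CI_{2h+1}(3412)| = |CI_{2h}(4321)| = |CI_{2h}(3412)| = Σ_{i=0}^{h} h!/((h−i)! ⌊i/2⌋! ⌈i/2⌉!)`.
>
> *Proof.* First of all, remark that a symmetric Motzkin path of length `2h+1` can be uniquely obtained by adding a
> horizontal step in the middle position of a symmetric Motzkin path of length `2h`. Hence, we can restrict our attention
> to the even case. A symmetric Motzkin path of length `2h` is completely determined by its first `h` steps. This means
> that we only need to count Motzkin prefixes of length `h`, whose formula can be found, for example, in [pg].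

(`[pg]` = O. Guibert, E. Pergola, *Enumeration of vexillary involutions which are equal to their mirror/complement*,
Discrete Math. **224** (2000) 281–287.)

## Contents

* §1 `motzkinPrefixes n` — words `w : Fin n → Fin 3` (`1 = U`, `2 = D`, `0 = H`) with at least as many `U` as `D` in
  every prefix (Motzkin paths of length `n` from the origin ending at any height); `motzkinWords n` are the balanced ones.
* §2–§3 «whose formula»: support sorting as in `MotzkinWords.lean` — a Motzkin prefix is its set `S` of non-level
  positions together with a left factor of a Dyck path on `S` (`extendWord_mem_motzkinPrefixes_iff`,
  `card_motzkinPrefixes_fiber`), whence ★★ `card_motzkinPrefixes_eq_sum`: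
  `#motzkinPrefixes h = Σ_{i ≤ h} binom(h, i) · binom(i, ⌊i/2⌋)` (`= Σ_i h!/((h−i)! ⌊i/2⌋! ⌈i/2⌉!)`,
  `factorial_form_of_summand`); values `1, 2, 5, 13, 35, 96`.
* §4 «a symmetric Motzkin path of length `2h` [or `2h+1`] is completely determined by its first `h` steps»:
  ★★ `symmetric_mem_motzkinWords_iff` (a mirror-symmetric word is a Motzkin word iff its first half is a Motzkin
  prefix) and ★★ `card_symmetric_motzkinWords`: `#{w ∈ motzkinWords n | w symmetric} = #motzkinPrefixes ⌊n/2⌋`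
  (restriction to the first half is a bijection; the middle letter of an odd symmetric word is `H`).
* §5 ★★★ THEOREM 13: `card_centrosymmetric_av3412_eq_sum` / `card_centrosymmetric_av4321_eq_sum`
  (`|CI_n(3412)| = |CI_n(4321)| = Σ_{i ≤ ⌊n/2⌋} binom(⌊n/2⌋, i) binom(i, ⌊i/2⌋)`) and
  `card_centrosymmetric_av4321_odd_eq_even` (`|CI_{2h+1}| = |CI_{2h}|`).
-/

open Finset

namespace Literature.Combinatorics.Enumerative

variable {n m : ℕ}

/-! ### §1 Motzkin prefixes -/

/-- **Motzkin prefixes** (left factors of Motzkin paths) of length `n`: words `w : Fin n → Fin 3` — `1` an up step,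
`2` a down step, `0` a level step — with at least as many up as down steps in every prefix (the path starts at the
origin and never dips below the axis; its final height is arbitrary).
[cite: BarnabeiBonettiSilimbani2011, Theorem 13 (proof: «Motzkin prefixes of length h»; arXiv 0812.0463)] -/
def motzkinPrefixes (n : ℕ) : Finset (Fin n → Fin 3) :=
  univ.filter fun w => ∀ t ≤ n, (univ.filter fun i : Fin n => (i : ℕ) < t ∧ w i = (2 : Fin 3)).card ≤
    (univ.filter fun i : Fin n => (i : ℕ) < t ∧ w i = (1 : Fin 3)).card

/-- Membership in `motzkinPrefixes n`. [cite: BarnabeiBonettiSilimbani2011, Theorem 13 (proof; arXiv 0812.0463)] -/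
theorem mem_motzkinPrefixes {w : Fin n → Fin 3} :
    w ∈ motzkinPrefixes n ↔ ∀ t ≤ n, (univ.filter fun i : Fin n => (i : ℕ) < t ∧ w i = (2 : Fin 3)).card ≤
      (univ.filter fun i : Fin n => (i : ℕ) < t ∧ w i = (1 : Fin 3)).card := by
  rw [motzkinPrefixes, mem_filter, and_iff_right (mem_univ _)]

/-- A Motzkin word is a Motzkin prefix (that happens to end on the axis): `motzkinWords n` are the balanced prefixes.
[cite: BarnabeiBonettiSilimbani2011, Theorem 13 (proof; arXiv 0812.0463)] -/
theorem motzkinWords_eq_filter_motzkinPrefixes (n : ℕ) :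
    motzkinWords n = (motzkinPrefixes n).filter fun w =>
      (univ.filter fun i => w i = (1 : Fin 3)).card = (univ.filter fun i => w i = (2 : Fin 3)).card := by
  ext w
  rw [mem_motzkinWords, mem_filter, mem_motzkinPrefixes]
  exact and_comm

/-- The empty word is the unique Motzkin prefix of length `0`.
[cite: BarnabeiBonettiSilimbani2011, Theorem 13 (proof; arXiv 0812.0463)] -/
theorem card_motzkinPrefixes_zero : (motzkinPrefixes 0).card = 1 := by
  rw [Finset.card_eq_one]
  refine ⟨fun i => Fin.elim0 i, Finset.ext fun w => ?_⟩
  simp only [mem_motzkinPrefixes, mem_singleton]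
  constructor
  · intro; exact funext fun i => Fin.elim0 i
  · rintro rfl t ht; simp

/-! ### §2 Planting a left factor of a Dyck path on the range of an order embedding -/

/-- Along an order embedding `e : Fin m ↪o Fin n`, the positions sent below `t` form an initial segment of `Fin m`,
of length `s_t = #{y : e y < t}` (re-proved from `MotzkinWords.lean`, where it is private).
[cite: BarnabeiBonettiSilimbani2011, Theorem 13 (proof; arXiv 0812.0463)] -/
private theorem lt_iff_lt_card' (e : Fin m ↪o Fin n) (t : ℕ) (x : Fin m) :
    ((e x : Fin n) : ℕ) < t ↔ (x : ℕ) < (univ.filter fun y : Fin m => ((e y : Fin n) : ℕ) < t).card := by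
  constructor
  · intro h
    have hsub : Iic x ⊆ univ.filter fun y : Fin m => ((e y : Fin n) : ℕ) < t := fun y hy => by
      rw [mem_Iic] at hy
      exact mem_filter.2 ⟨mem_univ _, lt_of_le_of_lt (Fin.le_def.1 (e.monotone hy)) h⟩
    have := card_le_card hsub
    rw [Fin.card_Iic] at this
    omega
  · intro h
    by_contra hx
    have hsub : (univ.filter fun y : Fin m => ((e y : Fin n) : ℕ) < t) ⊆ Iio x := fun y hy => by
      rw [mem_Iio]
      have hy' := (mem_filter.1 hy).2
      by_contra hxy
      exact hx (lt_of_le_of_lt (Fin.le_def.1 (e.monotone (not_lt.1 hxy))) hy')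
    have := card_le_card hsub
    rw [Fin.card_Iio] at this
    omega

/-- `#{x ∉ T : x < s} = s − #{x ∈ T : x < s}` for `s ≤ m` (re-proved from `MotzkinWords.lean`, where it is private).
[cite: BarnabeiBonettiSilimbani2011, Theorem 13 (proof; arXiv 0812.0463)] -/
private theorem card_compl_filter_lt' (T : Finset (Fin m)) {s : ℕ} (hs : s ≤ m) :
    (Tᶜ.filter fun x : Fin m => (x : ℕ) < s).card = s - (T.filter fun x : Fin m => (x : ℕ) < s).card := by
  have h1 : (T.filter fun x : Fin m => (x : ℕ) < s) = (univ.filter fun x : Fin m => (x : ℕ) < s).filter (· ∈ T) := by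
    ext x; simp only [mem_filter, mem_univ, true_and]; tauto
  have h2 : (Tᶜ.filter fun x : Fin m => (x : ℕ) < s) = (univ.filter fun x : Fin m => (x : ℕ) < s).filter (· ∉ T) := by
    ext x; simp only [mem_filter, mem_univ, true_and, mem_compl]; tauto
  have h3 := card_filter_add_card_filter_not (s := univ.filter fun x : Fin m => (x : ℕ) < s) (· ∈ T)
  rw [Fin.card_filter_val_lt, min_eq_right hs] at h3
  rw [h1, h2]
  omega

/-- ★ **A Motzkin prefix is a left factor of a Dyck path planted on its non-level positions**: the word `ext_e T`
(up steps at `e(T)`, down steps at `e(Tᶜ)`, level steps off the range of `e`) is a Motzkin prefix iff `T` is a weak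
ballot set, `t ≤ 2 · #{x ∈ T : x < t}` for all `t ≤ m`.
[cite: BarnabeiBonettiSilimbani2011, Theorem 13 (proof; arXiv 0812.0463)] -/
theorem extendWord_mem_motzkinPrefixes_iff (e : Fin m ↪o Fin n) (T : Finset (Fin m)) :
    Function.extend e (fun x => if x ∈ T then (1 : Fin 3) else (2 : Fin 3)) (fun _ => (0 : Fin 3)) ∈
        motzkinPrefixes n ↔ T ∈ weakBallotSets 1 m := by
  rw [mem_motzkinPrefixes, mem_weakBallotSets]
  -- prefix counts at `t`, in terms of `s_t`
  have hpre : ∀ t, ((univ.filter fun i : Fin n => (i : ℕ) < t ∧ Function.extend e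
      (fun x => if x ∈ T then (1 : Fin 3) else (2 : Fin 3)) (fun _ => (0 : Fin 3)) i = (2 : Fin 3)).card ≤
      (univ.filter fun i : Fin n => (i : ℕ) < t ∧ Function.extend e (fun x => if x ∈ T then (1 : Fin 3) else (2 : Fin 3))
        (fun _ => (0 : Fin 3)) i = (1 : Fin 3)).card) ↔
      (univ.filter fun y : Fin m => ((e y : Fin n) : ℕ) < t).card ≤
        2 * (T.filter fun x : Fin m => (x : ℕ) < (univ.filter fun y : Fin m => ((e y : Fin n) : ℕ) < t).card).card := by
    intro t
    have hs : (univ.filter fun y : Fin m => ((e y : Fin n) : ℕ) < t).card ≤ m := by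
      have := card_le_univ (univ.filter fun y : Fin m => ((e y : Fin n) : ℕ) < t); rwa [Fintype.card_fin] at this
    rw [card_filter_extendWord_eq_U, card_filter_extendWord_eq_D,
      filter_congr (s := T) (fun x _ => lt_iff_lt_card' e t x),
      filter_congr (s := Tᶜ) (fun x _ => lt_iff_lt_card' e t x), card_compl_filter_lt' T hs]
    omega
  constructor
  · intro hpref s hs
    rw [one_mul]
    rcases hs.lt_or_eq with hlt | heq
    · -- `s = s_t` for `t = e s`
      have ht := (hpre (e ⟨s, hlt⟩ : ℕ)).1 (hpref _ (e ⟨s, hlt⟩).2.le)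
      have hcard : (univ.filter fun y : Fin m => ((e y : Fin n) : ℕ) < ((e ⟨s, hlt⟩ : Fin n) : ℕ)).card = s := by
        rw [filter_congr (s := univ) (q := fun y : Fin m => (y : ℕ) < s) fun y _ => by
          rw [← Fin.lt_def, e.lt_iff_lt, Fin.lt_def], Fin.card_filter_val_lt, min_eq_right hlt.le]
      rwa [hcard] at ht
    · -- `s = m = s_n`
      rw [heq]
      have ht := (hpre n).1 (hpref n le_rfl)
      have hcard : (univ.filter fun y : Fin m => ((e y : Fin n) : ℕ) < n).card = m := by
        rw [filter_true_of_mem fun y _ => (e y).2, card_univ, Fintype.card_fin]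
      rwa [hcard] at ht
  · intro hball t _
    refine (hpre t).2 ?_
    have h := hball _ (show (univ.filter fun y : Fin m => ((e y : Fin n) : ℕ) < t).card ≤ m from by
      have := card_le_univ (univ.filter fun y : Fin m => ((e y : Fin n) : ℕ) < t); rwa [Fintype.card_fin] at this)
    rwa [one_mul] at h

/-! ### §3 Sorting Motzkin prefixes by their non-level positions -/

/-- ★★ **The fibre over a set of non-level positions**: the Motzkin prefixes of length `n` whose non-level positions
are exactly `S` correspond, by restriction along `S ≃o Fin |S|`, to the left factors of Dyck paths on `|S|` positions.
[cite: BarnabeiBonettiSilimbani2011, Theorem 13 (proof; arXiv 0812.0463)] -/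
theorem card_motzkinPrefixes_fiber (S : Finset (Fin n)) :
    ((motzkinPrefixes n).filter fun w => (univ.filter fun i => w i ≠ 0) = S).card =
      (weakBallotSets 1 S.card).card := by
  set e : Fin S.card ↪o Fin n := S.orderEmbOfFin rfl with he
  have hrange : ∀ y : Fin n, y ∈ Set.range e ↔ y ∈ S := fun y => by
    rw [he, range_orderEmbOfFin, mem_coe]
  refine card_nbij' (fun w => univ.filter fun x : Fin S.card => w (e x) = (1 : Fin 3))
    (fun T => Function.extend e (fun x => if x ∈ T then (1 : Fin 3) else (2 : Fin 3)) fun _ => (0 : Fin 3))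
    (fun w hw => ?_) (fun T hT => ?_) (fun w hw => ?_) (fun T _ => ?_)
  · -- into the ballot sets: rewrite `w` as the planting of its own `U`-set
    dsimp only
    rw [mem_coe, mem_filter] at hw
    obtain ⟨hw, hsupp⟩ := hw
    have hsupp' : ∀ y, w y ≠ 0 ↔ y ∈ S := fun y => by
      rw [← hsupp]; simp
    have hext : Function.extend e (fun x => if x ∈ (univ.filter fun x : Fin S.card => w (e x) = (1 : Fin 3))
        then (1 : Fin 3) else (2 : Fin 3)) (fun _ => (0 : Fin 3)) = w := by
      funext y
      by_cases hy : y ∈ Set.range e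
      · obtain ⟨x, rfl⟩ := hy
        rw [extendWord_apply_of_mem]
        simp only [mem_filter, mem_univ, true_and]
        have hne : w (e x) ≠ 0 := (hsupp' _).2 ((hrange _).1 ⟨x, rfl⟩)
        rcases (show ∀ v : Fin 3, v = 0 ∨ v = 1 ∨ v = 2 by decide) (w (e x)) with h | h | h
        · exact absurd h hne
        · rw [h]; simp
        · rw [h]; simp
      · rw [extendWord_apply_of_not_mem e _ hy]
        have : ¬ (w y ≠ 0) := fun h => hy ((hrange y).2 ((hsupp' y).1 h))
        exact (not_not.1 this).symm
    rw [mem_coe]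
    exact (extendWord_mem_motzkinPrefixes_iff e _).1 (by rw [hext]; exact hw)
  · -- from the ballot sets: the planted word is a Motzkin prefix with support `S`
    dsimp only
    rw [mem_coe] at hT
    rw [mem_coe, mem_filter]
    refine ⟨(extendWord_mem_motzkinPrefixes_iff e T).2 hT, Finset.ext fun y => ?_⟩
    simp only [mem_filter, mem_univ, true_and]
    rw [extendWord_ne_zero_iff, hrange]
  · -- left inverse
    dsimp only
    rw [mem_coe, mem_filter] at hw
    obtain ⟨-, hsupp⟩ := hw
    have hsupp' : ∀ y, w y ≠ 0 ↔ y ∈ S := fun y => by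
      rw [← hsupp]; simp
    funext y
    by_cases hy : y ∈ Set.range e
    · obtain ⟨x, rfl⟩ := hy
      rw [extendWord_apply_of_mem]
      simp only [mem_filter, mem_univ, true_and]
      have hne : w (e x) ≠ 0 := (hsupp' _).2 ((hrange _).1 ⟨x, rfl⟩)
      rcases (show ∀ v : Fin 3, v = 0 ∨ v = 1 ∨ v = 2 by decide) (w (e x)) with h | h | h
      · exact absurd h hne
      · rw [h]; simp
      · rw [h]; simp
    · rw [extendWord_apply_of_not_mem e _ hy]
      have : ¬ (w y ≠ 0) := fun h => hy ((hrange y).2 ((hsupp' y).1 h))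
      exact (not_not.1 this).symm
  · -- right inverse
    dsimp only
    ext x
    simp only [mem_filter, mem_univ, true_and]
    rw [extendWord_apply_of_mem]
    split_ifs with hx <;> simp [hx]

/-- ★★ **Sorting by the non-level positions**: `#motzkinPrefixes n = Σ_{S ⊆ [n]} #(left factors of Dyck paths on |S|
positions)`. [cite: BarnabeiBonettiSilimbani2011, Theorem 13 (proof; arXiv 0812.0463)] -/
theorem card_motzkinPrefixes_eq_sum_support (n : ℕ) :
    (motzkinPrefixes n).card = ∑ S : Finset (Fin n), (weakBallotSets 1 S.card).card := by
  rw [card_eq_sum_card_fiberwise (f := fun w : Fin n → Fin 3 => univ.filter fun i => w i ≠ 0)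
    (t := univ) fun w _ => mem_coe.2 (mem_univ _)]
  exact sum_congr rfl fun S _ => card_motzkinPrefixes_fiber S

/-- ★★ **The number of Motzkin prefixes**: `#motzkinPrefixes h = Σ_{i=0}^{h} binom(h, i) · binom(i, ⌊i/2⌋)` — choose
the `i` non-level positions, then one of the `binom(i, ⌊i/2⌋)` left factors of Dyck paths on them
(`card_weakBallotSets_one`).  This is the sum «whose formula can be found, for example, in [pg]» of Theorem 13.
[cite: BarnabeiBonettiSilimbani2011, Theorem 13 (arXiv 0812.0463)] -/
theorem card_motzkinPrefixes_eq_sum (h : ℕ) :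
    (motzkinPrefixes h).card = ∑ i ∈ range (h + 1), h.choose i * i.choose (i / 2) := by
  rw [card_motzkinPrefixes_eq_sum_support, ← powerset_univ,
    sum_powerset_apply_card (fun m => (weakBallotSets 1 m).card), card_univ, Fintype.card_fin]
  refine sum_congr rfl fun i _ => ?_
  rw [card_weakBallotSets_one, smul_eq_mul]

/-- The summand as printed: `h!/((h−i)! ⌊i/2⌋! ⌈i/2⌉!) = binom(h, i) · binom(i, ⌊i/2⌋)` for `i ≤ h`
(`⌈i/2⌉ = (i+1)/2 = i − ⌊i/2⌋`). [cite: BarnabeiBonettiSilimbani2011, Theorem 13 (arXiv 0812.0463)] -/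
theorem factorial_form_of_summand {h i : ℕ} (hi : i ≤ h) :
    Nat.factorial h / (Nat.factorial (h - i) * Nat.factorial (i / 2) * Nat.factorial ((i + 1) / 2)) =
        h.choose i * i.choose (i / 2) ∧
      Nat.factorial (h - i) * Nat.factorial (i / 2) * Nat.factorial ((i + 1) / 2) * (h.choose i * i.choose (i / 2)) =
        Nat.factorial h := by
  have h1 := Nat.choose_mul_factorial_mul_factorial hi
  have h2 := Nat.choose_mul_factorial_mul_factorial (Nat.div_le_self i 2)
  rw [show i - i / 2 = (i + 1) / 2 by omega] at h2
  have key : Nat.factorial (h - i) * Nat.factorial (i / 2) * Nat.factorial ((i + 1) / 2) *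
      (h.choose i * i.choose (i / 2)) = Nat.factorial h := by
    calc Nat.factorial (h - i) * Nat.factorial (i / 2) * Nat.factorial ((i + 1) / 2) * (h.choose i * i.choose (i / 2))
        = h.choose i * (i.choose (i / 2) * Nat.factorial (i / 2) * Nat.factorial ((i + 1) / 2)) *
            Nat.factorial (h - i) := by ring
      _ = Nat.factorial h := by rw [h2, h1]
  refine ⟨?_, key⟩
  rw [← key, Nat.mul_div_cancel_left _ (by positivity)]

/-- The first values of `#motzkinPrefixes h`: `1, 2, 5, 13, 35, 96` (`h = 0, …, 5`).
[cite: BarnabeiBonettiSilimbani2011, Theorem 13 (arXiv 0812.0463)] -/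
theorem card_motzkinPrefixes_values :
    ((List.range 6).map fun h => ∑ i ∈ range (h + 1), h.choose i * i.choose (i / 2)) = [1, 2, 5, 13, 35, 96] ∧
      (motzkinPrefixes 5).card = 96 := by
  refine ⟨by decide, ?_⟩
  rw [card_motzkinPrefixes_eq_sum]
  decide

/-! ### §4 Symmetric Motzkin words are determined by their first half -/

section Symmetric

/-- Prefix counts of the first half: for `t ≤ ⌊n/2⌋`, the letters `c` among the first `t` letters of the first half of
`w` are those among the first `t` letters of `w`.
[cite: BarnabeiBonettiSilimbani2011, Theorem 13 (proof: «completely determined by its first `h` steps»; arXiv 0812.0463)] -/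
theorem card_filter_lt_firstHalf (w : Fin n → Fin 3) (c : Fin 3) {t : ℕ} (ht : t ≤ n / 2) :
    (univ.filter fun i : Fin (n / 2) => (i : ℕ) < t ∧ w (Fin.castLE (Nat.div_le_self n 2) i) = c).card =
      (univ.filter fun i : Fin n => (i : ℕ) < t ∧ w i = c).card := by
  rw [← card_map (Fin.castLEEmb (Nat.div_le_self n 2))]
  refine congrArg Finset.card (Finset.ext fun i => ?_)
  simp only [mem_map, mem_filter, mem_univ, true_and, Fin.coe_castLEEmb]
  constructor
  · rintro ⟨a, ⟨ha, hc⟩, rfl⟩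
    exact ⟨ha, hc⟩
  · rintro ⟨hi, hc⟩
    exact ⟨⟨i, by omega⟩, ⟨hi, hc⟩, Fin.ext rfl⟩

/-- Splitting a letter count at `t`: `#{i : w i = c} = #{i < t : w i = c} + #{i ≥ t : w i = c}`.
[cite: BarnabeiBonettiSilimbani2011, Theorem 13 (proof; arXiv 0812.0463)] -/
theorem card_filter_eq_add (w : Fin n → Fin 3) (c : Fin 3) (t : ℕ) :
    (univ.filter fun i : Fin n => w i = c).card =
      (univ.filter fun i : Fin n => (i : ℕ) < t ∧ w i = c).card +
        (univ.filter fun i : Fin n => ¬ (i : ℕ) < t ∧ w i = c).card := by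
  rw [← card_filter_add_card_filter_not (s := univ.filter fun i : Fin n => w i = c) (fun i => (i : ℕ) < t),
    filter_filter, filter_filter]
  congr 1
  · exact congrArg Finset.card (filter_congr fun i _ => and_comm)
  · exact congrArg Finset.card (filter_congr fun i _ => and_comm)

/-- In a mirror-symmetric word (`w (n−1−i) = w̄ i`, `Ū = D`, `D̄ = U`, `H̄ = H`) the up steps among the LAST `s`
letters are as many as the down steps among the FIRST `s` letters, and vice versa.
[cite: BarnabeiBonettiSilimbani2011, Theorem 13 (proof; arXiv 0812.0463)] -/
theorem card_filter_ge_eq_of_symmetric {w : Fin n → Fin 3} (hw : ∀ i, w (Fin.rev i) = ![0, 2, 1] (w i))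
    {s : ℕ} (hs : s ≤ n) :
    (univ.filter fun i : Fin n => ¬ (i : ℕ) < n - s ∧ w i = (1 : Fin 3)).card =
        (univ.filter fun i : Fin n => (i : ℕ) < s ∧ w i = (2 : Fin 3)).card ∧
      (univ.filter fun i : Fin n => ¬ (i : ℕ) < n - s ∧ w i = (2 : Fin 3)).card =
        (univ.filter fun i : Fin n => (i : ℕ) < s ∧ w i = (1 : Fin 3)).card := by
  have key : ∀ c : Fin 3, (univ.filter fun i : Fin n => ¬ (i : ℕ) < n - s ∧ w i = c).card =
      (univ.filter fun i : Fin n => (i : ℕ) < s ∧ w i = ![0, 2, 1] c).card := by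
    intro c
    refine card_nbij' (fun i => Fin.rev i) (fun i => Fin.rev i) (fun i hi => ?_) (fun i hi => ?_)
      (fun i _ => Fin.rev_rev i) (fun i _ => Fin.rev_rev i)
    · rw [mem_coe, mem_filter] at hi ⊢
      refine ⟨mem_univ _, ?_, by rw [hw, hi.2.2]⟩
      have := hi.2.1
      rw [Fin.val_rev]
      omega
    · rw [mem_coe, mem_filter] at hi ⊢
      refine ⟨mem_univ _, ?_, ?_⟩
      · have := hi.2.1
        rw [Fin.val_rev]
        omega
      · have h := hw i
        rw [hi.2.2] at h
        rw [h]
        exact (show ∀ c : Fin 3, (![0, 2, 1] (![0, 2, 1] c) : Fin 3) = c by decide) c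
  exact ⟨key 1, key 2⟩

/-- ★★ **A symmetric word is a Motzkin word iff its first half is a Motzkin prefix** («a symmetric Motzkin path of
length `2h` is completely determined by its first `h` steps»; for odd length the middle letter of a symmetric word is
forced to be level): the up/down balance is automatic by symmetry, the prefix condition for `t ≤ ⌊n/2⌋` is that of the
first half, and for `t ≥ ⌈n/2⌉` it is the prefix condition at `n − t ≤ ⌊n/2⌋` reflected.
[cite: BarnabeiBonettiSilimbani2011, Theorem 13 (proof; arXiv 0812.0463)] -/
theorem symmetric_mem_motzkinWords_iff {w : Fin n → Fin 3} (hw : ∀ i, w (Fin.rev i) = ![0, 2, 1] (w i)) :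
    w ∈ motzkinWords n ↔ (fun i : Fin (n / 2) => w (Fin.castLE (Nat.div_le_self n 2) i)) ∈ motzkinPrefixes (n / 2) := by
  rw [mem_motzkinWords, mem_motzkinPrefixes]
  constructor
  · rintro ⟨-, hpref⟩ t ht
    rw [card_filter_lt_firstHalf w 2 ht, card_filter_lt_firstHalf w 1 ht]
    exact hpref t (ht.trans (Nat.div_le_self n 2))
  · intro hp
    have hp' : ∀ t ≤ n / 2, (univ.filter fun i : Fin n => (i : ℕ) < t ∧ w i = (2 : Fin 3)).card ≤
        (univ.filter fun i : Fin n => (i : ℕ) < t ∧ w i = (1 : Fin 3)).card := fun t ht => by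
      rw [← card_filter_lt_firstHalf w 2 ht, ← card_filter_lt_firstHalf w 1 ht]
      exact hp t ht
    -- balance, by symmetry (`s = n`)
    have hbal : (univ.filter fun i : Fin n => w i = (1 : Fin 3)).card =
        (univ.filter fun i : Fin n => w i = (2 : Fin 3)).card := by
      have h := (card_filter_ge_eq_of_symmetric hw le_rfl).1
      rw [Nat.sub_self,
        filter_congr (s := (univ : Finset (Fin n)))
          (fun i _ => show (¬ (i : ℕ) < 0 ∧ w i = (1 : Fin 3)) ↔ w i = 1 by simp),
        filter_congr (s := (univ : Finset (Fin n)))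
          (fun i _ => show ((i : ℕ) < n ∧ w i = (2 : Fin 3)) ↔ w i = 2 by simp [i.2])] at h
      exact h
    refine ⟨hbal, fun t ht => ?_⟩
    rcases Nat.lt_or_ge (n / 2) t with h1 | h1
    swap
    · exact hp' t h1
    · -- `t > n/2`: reflect the prefix condition at `s = n - t ≤ n/2`
      have hs : n - t ≤ n / 2 := by omega
      obtain ⟨hU, hD⟩ := card_filter_ge_eq_of_symmetric hw (Nat.sub_le n t)
      rw [Nat.sub_sub_self ht] at hU hD
      have e1 := card_filter_eq_add w 1 t
      have e2 := card_filter_eq_add w 2 t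
      have h3 := hp' (n - t) hs
      omega

/-- The gluing map: a word of length `⌊n/2⌋` extended by mirror symmetry (and a level step in the middle when `n` is
odd) to a word of length `n`. [cite: BarnabeiBonettiSilimbani2011, Theorem 13 (proof; arXiv 0812.0463)] -/
private def mirrorGlue (n : ℕ) (p : Fin (n / 2) → Fin 3) : Fin n → Fin 3 := fun j =>
  if hj : (j : ℕ) < n / 2 then p ⟨j, hj⟩
  else if hj' : n - 1 - (j : ℕ) < n / 2 then ![0, 2, 1] (p ⟨n - 1 - j, hj'⟩) else 0

/-- The glued word on the first half. [cite: BarnabeiBonettiSilimbani2011, Theorem 13 (proof; arXiv 0812.0463)] -/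
private theorem mirrorGlue_apply_of_lt (p : Fin (n / 2) → Fin 3) {j : Fin n} (hj : (j : ℕ) < n / 2) :
    mirrorGlue n p j = p ⟨j, hj⟩ := by
  unfold mirrorGlue; rw [dif_pos hj]

/-- The glued word on the mirrored half. [cite: BarnabeiBonettiSilimbani2011, Theorem 13 (proof; arXiv 0812.0463)] -/
private theorem mirrorGlue_apply_of_rev_lt (p : Fin (n / 2) → Fin 3) {j : Fin n} (hj : n - 1 - (j : ℕ) < n / 2) :
    mirrorGlue n p j = ![0, 2, 1] (p ⟨n - 1 - j, hj⟩) := by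
  have h1 : ¬ (j : ℕ) < n / 2 := by have := j.2; omega
  unfold mirrorGlue; rw [dif_neg h1, dif_pos hj]

/-- The glued word in the middle (odd length): a level step. [cite: BarnabeiBonettiSilimbani2011, Theorem 13 (proof; arXiv 0812.0463)] -/
private theorem mirrorGlue_apply_mid (p : Fin (n / 2) → Fin 3) {j : Fin n} (h1 : ¬ (j : ℕ) < n / 2)
    (h2 : ¬ n - 1 - (j : ℕ) < n / 2) : mirrorGlue n p j = 0 := by
  unfold mirrorGlue; rw [dif_neg h1, dif_neg h2]

/-- The glued word is mirror-symmetric. [cite: BarnabeiBonettiSilimbani2011, Theorem 13 (proof; arXiv 0812.0463)] -/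
private theorem mirrorGlue_symmetric (p : Fin (n / 2) → Fin 3) (j : Fin n) :
    mirrorGlue n p (Fin.rev j) = ![0, 2, 1] (mirrorGlue n p j) := by
  have hj := j.2
  have hrev : ((Fin.rev j : Fin n) : ℕ) = n - 1 - j := by rw [Fin.val_rev]; omega
  by_cases h1 : (j : ℕ) < n / 2
  · have h2 : n - 1 - ((Fin.rev j : Fin n) : ℕ) < n / 2 := by rw [hrev]; omega
    rw [mirrorGlue_apply_of_rev_lt p h2, mirrorGlue_apply_of_lt p h1]
    congr 2
    exact Fin.ext (by simp only [hrev]; omega)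
  · by_cases h2 : n - 1 - (j : ℕ) < n / 2
    · have h3 : ((Fin.rev j : Fin n) : ℕ) < n / 2 := by rw [hrev]; exact h2
      rw [mirrorGlue_apply_of_lt p h3, mirrorGlue_apply_of_rev_lt p h2]
      have e : (⟨((Fin.rev j : Fin n) : ℕ), h3⟩ : Fin (n / 2)) = ⟨n - 1 - j, h2⟩ := Fin.ext (by simp only [hrev])
      rw [e]
      generalize p ⟨n - 1 - j, h2⟩ = c
      revert c; decide
    · have h3 : ¬ ((Fin.rev j : Fin n) : ℕ) < n / 2 := by rw [hrev]; exact h2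
      have h4 : ¬ n - 1 - ((Fin.rev j : Fin n) : ℕ) < n / 2 := by rw [hrev]; omega
      rw [mirrorGlue_apply_mid p h3 h4, mirrorGlue_apply_mid p h1 h2]
      decide

/-- The first half of the glued word is the original word. [cite: BarnabeiBonettiSilimbani2011, Theorem 13 (proof; arXiv 0812.0463)] -/
private theorem firstHalf_mirrorGlue (p : Fin (n / 2) → Fin 3) :
    (fun i : Fin (n / 2) => mirrorGlue n p (Fin.castLE (Nat.div_le_self n 2) i)) = p := by
  funext i
  rw [mirrorGlue_apply_of_lt p (by exact i.2)]
  exact congrArg p (Fin.ext rfl)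

/-- A symmetric word is the gluing of its first half. [cite: BarnabeiBonettiSilimbani2011, Theorem 13 (proof; arXiv 0812.0463)] -/
private theorem mirrorGlue_firstHalf {w : Fin n → Fin 3} (hw : ∀ i, w (Fin.rev i) = ![0, 2, 1] (w i)) :
    mirrorGlue n (fun i : Fin (n / 2) => w (Fin.castLE (Nat.div_le_self n 2) i)) = w := by
  funext j
  have hj := j.2
  by_cases h1 : (j : ℕ) < n / 2
  · rw [mirrorGlue_apply_of_lt _ h1]
    rfl
  · by_cases h2 : n - 1 - (j : ℕ) < n / 2
    · rw [mirrorGlue_apply_of_rev_lt _ h2]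
      have e : Fin.castLE (Nat.div_le_self n 2) ⟨n - 1 - j, h2⟩ = Fin.rev j :=
        Fin.ext (by simp only [Fin.val_castLE, Fin.val_rev]; omega)
      simp only [e, hw]
      generalize w j = c
      revert c; decide
    · rw [mirrorGlue_apply_mid _ h1 h2]
      -- the middle letter of an odd symmetric word is level
      have e : Fin.rev j = j := Fin.ext (by rw [Fin.val_rev]; omega)
      have h := hw j
      rw [e] at h
      revert h
      generalize w j = c
      revert c; decide

/-- ★★ **Symmetric Motzwords ↔ Motzkin prefixes of half length** («we only need to count Motzkin prefixes of
length `h`»; the odd case «by adding a horizontal step in the middle position»): restriction to the first `⌊n/2⌋`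
letters is a bijection from the mirror-symmetric Motzkin words of length `n` onto the Motzkin prefixes of length
`⌊n/2⌋`. [cite: BarnabeiBonettiSilimbani2011, Theorem 13 (proof; arXiv 0812.0463)] -/
theorem card_symmetric_motzkinWords (n : ℕ) :
    ((motzkinWords n).filter fun w => ∀ i, w (Fin.rev i) = ![0, 2, 1] (w i)).card = (motzkinPrefixes (n / 2)).card := by
  refine card_nbij' (fun w => fun i : Fin (n / 2) => w (Fin.castLE (Nat.div_le_self n 2) i)) (mirrorGlue n)
    (fun w hw => ?_) (fun p hp => ?_) (fun w hw => ?_) (fun p _ => firstHalf_mirrorGlue p)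
  · rw [mem_coe, mem_filter] at hw
    exact (symmetric_mem_motzkinWords_iff hw.2).1 hw.1
  · rw [mem_coe] at hp
    rw [mem_coe, mem_filter]
    refine ⟨(symmetric_mem_motzkinWords_iff (mirrorGlue_symmetric p)).2 ?_, mirrorGlue_symmetric p⟩
    rw [firstHalf_mirrorGlue]
    exact hp
  · rw [mem_coe, mem_filter] at hw
    exact mirrorGlue_firstHalf hw.2

/-- The odd case reduces to the even case: symmetric Motzkin words of length `2h+1` and of length `2h` are
equinumerous (both are counted by the Motzkin prefixes of length `h`).
[cite: BarnabeiBonettiSilimbani2011, Theorem 13 (proof: «by adding a horizontal step in the middle position»; arXiv 0812.0463)] -/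
theorem card_symmetric_motzkinWords_odd (h : ℕ) :
    ((motzkinWords (2 * h + 1)).filter fun w => ∀ i, w (Fin.rev i) = ![0, 2, 1] (w i)).card =
      ((motzkinWords (2 * h)).filter fun w => ∀ i, w (Fin.rev i) = ![0, 2, 1] (w i)).card := by
  rw [card_symmetric_motzkinWords, card_symmetric_motzkinWords,
    show (2 * h + 1) / 2 = h by omega, show 2 * h / 2 = h by omega]

end Symmetric

/-! ### §5 Theorem 13 -/

namespace PermContainsPattern

open Equiv

/-- ★★★ **THEOREM 13 for `3412`**: the centrosymmetric `3412`-avoiding involutions of `[n]` number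
`Σ_{i=0}^{h} binom(h, i) binom(i, ⌊i/2⌋)`, `h = ⌊n/2⌋` (`= Σ_i h!/((h−i)! ⌊i/2⌋! ⌈i/2⌉!)`, `factorial_form_of_summand`).
[cite: BarnabeiBonettiSilimbani2011, Theorem 13 (arXiv 0812.0463)] -/
theorem card_centrosymmetric_av3412_eq_sum (n : ℕ) :
    Nat.card {u : Perm (Fin n) // (u * u = 1 ∧ ¬ PermContainsPattern u ![3, 4, 1, 2]) ∧
        ∀ i, u (Fin.rev i) = Fin.rev (u i)} =
      ∑ i ∈ range (n / 2 + 1), (n / 2).choose i * i.choose (i / 2) := by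
  rw [card_centrosymmetric_av3412_eq_card_symmetric_motzkinWords, card_symmetric_motzkinWords,
    card_motzkinPrefixes_eq_sum]

/-- ★★★ **THEOREM 13 for `4321`**: the centrosymmetric `4321`-avoiding involutions of `[n]` number
`Σ_{i=0}^{h} binom(h, i) binom(i, ⌊i/2⌋)`, `h = ⌊n/2⌋`. [cite: BarnabeiBonettiSilimbani2011, Theorem 13 (arXiv 0812.0463)] -/
theorem card_centrosymmetric_av4321_eq_sum (n : ℕ) :
    Nat.card {u : Perm (Fin n) // (u * u = 1 ∧ ¬ PermContainsPattern u ![4, 3, 2, 1]) ∧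
        ∀ i, u (Fin.rev i) = Fin.rev (u i)} =
      ∑ i ∈ range (n / 2 + 1), (n / 2).choose i * i.choose (i / 2) := by
  rw [card_centrosymmetric_av4321_eq_av3412, card_centrosymmetric_av3412_eq_sum]

/-- **THEOREM 13, `|CI_{2h+1}(4321)| = |CI_{2h}(4321)|` and `|CI_{2h+1}(3412)| = |CI_{2h}(3412)|`.**
[cite: BarnabeiBonettiSilimbani2011, Theorem 13 (arXiv 0812.0463)] -/
theorem card_centrosymmetric_odd_eq_even (h : ℕ) :
    Nat.card {u : Perm (Fin (2 * h + 1)) // (u * u = 1 ∧ ¬ PermContainsPattern u ![4, 3, 2, 1]) ∧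
          ∀ i, u (Fin.rev i) = Fin.rev (u i)} =
        Nat.card {u : Perm (Fin (2 * h)) // (u * u = 1 ∧ ¬ PermContainsPattern u ![4, 3, 2, 1]) ∧
          ∀ i, u (Fin.rev i) = Fin.rev (u i)} ∧
      Nat.card {u : Perm (Fin (2 * h + 1)) // (u * u = 1 ∧ ¬ PermContainsPattern u ![3, 4, 1, 2]) ∧
          ∀ i, u (Fin.rev i) = Fin.rev (u i)} =
        Nat.card {u : Perm (Fin (2 * h)) // (u * u = 1 ∧ ¬ PermContainsPattern u ![3, 4, 1, 2]) ∧
          ∀ i, u (Fin.rev i) = Fin.rev (u i)} := by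
  rw [card_centrosymmetric_av4321_eq_sum, card_centrosymmetric_av4321_eq_sum, card_centrosymmetric_av3412_eq_sum,
    card_centrosymmetric_av3412_eq_sum, show (2 * h + 1) / 2 = h by omega, show 2 * h / 2 = h by omega]
  exact ⟨rfl, rfl⟩

/-- Theorem 13 in the printed indexing: `|CI_{2h}(4321)| = Σ_{i=0}^{h} binom(h,i) binom(i,⌊i/2⌋)`, and the first values
`1, 2, 5, 13, 35, 96` for `h = 0, …, 5`. [cite: BarnabeiBonettiSilimbani2011, Theorem 13 (arXiv 0812.0463)] -/
theorem card_centrosymmetric_av4321_two_mul (h : ℕ) :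
    Nat.card {u : Perm (Fin (2 * h)) // (u * u = 1 ∧ ¬ PermContainsPattern u ![4, 3, 2, 1]) ∧
        ∀ i, u (Fin.rev i) = Fin.rev (u i)} = ∑ i ∈ range (h + 1), h.choose i * i.choose (i / 2) := by
  rw [card_centrosymmetric_av4321_eq_sum, show 2 * h / 2 = h by omega]

end PermContainsPattern

end Literature.Combinatorics.Enumerative
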